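import Summits.KontsevichZagierPeriods.Zeta5Search.Barrier.ConeGammaEnvelope

/-!
# ζ(5) search — BARRIER: `C₀` TO FIRST ORDER IN THE FAR CHART — the centre slice (real side)

HONEST FRAMING (cell `pub-zeta5`): systematic search; no irrationality claim unless kernel-certified. MODEL objects under
Brown–Zudilin's (28)+(30) accounting ([BZ22] = arXiv:2210.03391, §5; (28) observed, not proved): cert-2 g39's value function
`Envelope.valueV` (the 21 entropy forms of BZ's growth functional at critical points, `ConeGammaEnvelope`). Nothing here is
a statement about the size of any critical value of record, any γ, the cone's supremum (C2 OPEN), S-E (CONJECTURED), (TD_A)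
or `ζ(5)`; no number of record moves; records in print UNMOVED. Theory seat cert-2 g40 (item «C₀ TO FIRST ORDER IN THE FAR
CHART — THE CENTRE-SLICE CERTIFICATE», INBOX plan 2026-08-27), part 1 (real side; the checker is `ConeGammaFarSliceCheck`, its
soundness `ConeGammaFarSliceSound`).

THE FAR CHART (cert-2 g38's `z = 1/Y`, `Y = y − s₆`). Split g39's 21 forms into the 13 `Y`-free forms (`aforms`: the six
`X`-forms and the seven constant arguments) and the 8 `Y`-forms `L_k = β′_k Y + m_k(s, X)` (`kforms`, `β′_k = ±1`). Since
`Σ σ_k β′_k = 0` and `Σ σ_k m_k ≡ 0` (`sum_sg_mval`), for `z ≠ 0`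
**`valueV s X z⁻¹ = valA s X + valH s X z / z`**, `valH s X z = Σ_k σ_k·xlnx(β′_k + z·m_k(s, X))` (`valueV_far`): the
`Y`-part of the value is `H/z` with `H` a sum of `xlnx` of forms that stay BOUNDED when `Y` does not.
* `kform_secant` — the SECANT in the direction at a fixed far point `(X, z)`:
  `(xlnx(β′ + z·m(t)) − xlnx(β′ + z·m(c)))/z = θ·(m(t) − m(c))` with `θ` between `log m̃` and `log M̃`
  (`m̃ ≤ |β′ + z·m| ≤ M̃`; g39's `xlnx_secant`; the `1/z` cancels EXACTLY against the `z` of the argument difference);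
* `tanD`, the four one-sided TANGENT-DIFFERENCE bounds per sign pattern (g39's `xlnx_tangent_quad_pos/neg`) and the identity
  `valF_tangent` (`valF F s b Y − valF F s a Y − (b − a)·gxF F s a Y = Σ σ_k·tanD`);
* **`tangent_chain`** — local two-point tangent inequalities `f b ≤ f a + (b − a)·g a` on CONSECUTIVE pieces of an
  interval imply the global one (calculus-free: the local inequalities make `g` antitone piece by piece and telescope), and
  `le_of_tangent_of_eq_zero` — at a point where `g = 0` the function is maximal on the interval.
-/

noncomputable section

open Finset Set

namespace Summit.KontsevichZagierPeriods.Zeta5Search.Barrier.ConeGamma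

namespace FarSlice

open Envelope (EForm formVal vforms valF gxF valueV valF_cons valF_nil gxF_cons gxF_nil xlnx_secant
  xlnx_tangent_quad_pos xlnx_tangent_quad_neg)
open LemmaFBox (coef featVal)

/-! ### The 13 + 8 split of the 21 forms -/

/-- The thirteen `Y`-free forms of `vforms` (the six `X`-forms `X+s₆`, `s₀−X`, `s₃+s₄+s₅−X`, `X−s₄`, `X−s₃`, `X−s₅` and the
seven constant arguments), in `vforms`' order. -/
def aforms : List EForm :=
  [⟨1, [0,0,0,0,0,0,1,0], 1, 0⟩,
   ⟨-1, [1,0,0,0,0,0,0,0], -1, 0⟩, ⟨-1, [0,0,0,1,1,1,0,0], -1, 0⟩, ⟨-1, [0,0,0,0,-1,0,0,0], 1, 0⟩,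
   ⟨-1, [0,0,0,-1,0,0,0,0], 1, 0⟩, ⟨-1, [0,0,0,0,0,-1,0,0], 1, 0⟩,
   ⟨1, [1,0,0,-1,0,0,0,0], 0, 0⟩, ⟨1, [0,0,0,1,1,0,0,0], 0, 0⟩, ⟨1, [0,1,1,0,0,0,0,0], 0, 0⟩, ⟨1, [1,0,-1,0,0,0,0,0], 0, 0⟩,
   ⟨-1, [0,0,0,0,1,0,1,0], 0, 0⟩, ⟨-1, [1,0,0,0,0,0,-1,0], 0, 0⟩, ⟨-1, [0,1,0,0,0,0,1,0], 0, 0⟩]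

/-- A `Y`-form of the value function in the far chart: `L = β′·Y + m(s, X)`, `m(s, X) = α·s + β·X`, sign `σ`. -/
structure KForm where
  /-- sign `σ ∈ {1, −1}` -/
  sg : ℤ
  /-- the `Y`-coefficient `β′ ∈ {1, −1}` -/
  bp : ℤ
  /-- coefficients of `s₀, …, s₇` in `m` -/
  al : List ℤ
  /-- coefficient of `X` in `m` -/
  bx : ℤ
  deriving DecidableEq, Repr

/-- The eight `Y`-forms (`vforms` entries 1, 2, 8–13): `Y+s₆`, `X+Y`, `−(X+Y+s₆−s₀)`, `−(s₁+s₂+s₇−Y)`, `−(s₀−Y)`, `−(Y−s₇)`,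
`−(Y−s₂)`, `−(Y−s₁)` (sign, `β′`, `α`, `β`). -/
def kforms : List KForm :=
  [⟨1, 1, [0,0,0,0,0,0,1,0], 0⟩, ⟨1, 1, [0,0,0,0,0,0,0,0], 1⟩, ⟨-1, 1, [-1,0,0,0,0,0,1,0], 1⟩,
   ⟨-1, -1, [0,1,1,0,0,0,0,1], 0⟩, ⟨-1, -1, [1,0,0,0,0,0,0,0], 0⟩,
   ⟨-1, 1, [0,0,0,0,0,0,0,-1], 0⟩, ⟨-1, 1, [0,0,-1,0,0,0,0,0], 0⟩, ⟨-1, 1, [0,-1,0,0,0,0,0,0], 0⟩]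

/-- The `Y`-free part `m(s, X) = α·s + β·X` of a `Y`-form. -/
def mval (f : KForm) (s : Fin 8 → ℝ) (X : ℝ) : ℝ := featVal f.al s + (f.bx : ℝ) * X

/-- The `Y`-free part of the value function: the thirteen forms. -/
def valA (s : Fin 8 → ℝ) (X : ℝ) : ℝ := valF aforms s X 0

/-- The RESOLVED `Y`-part: `H(s, X, z) = Σ_k σ_k·xlnx(β′_k + z·m_k(s, X))`. -/
def valH (s : Fin 8 → ℝ) (X z : ℝ) : ℝ := (kforms.map fun f => (f.sg : ℝ) * xlnx ((f.bp : ℝ) + z * mval f s X)).sum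

/-- `K = H/z`, the `Y`-part of the value in the far chart. -/
def valK (s : Fin 8 → ℝ) (X z : ℝ) : ℝ := valH s X z / z

/-- `valA` does not depend on the `Y`-slot. -/
theorem valF_aforms_Y (s : Fin 8 → ℝ) (X Y : ℝ) : valF aforms s X Y = valA s X := by
  simp only [valA, valF, aforms, formVal, List.map_cons, List.map_nil, Int.cast_zero, zero_mul, add_zero]

/-- `valA` written out. -/
theorem valA_eq (s : Fin 8 → ℝ) (X : ℝ) :
    valA s X = xlnx (X + s 6) - xlnx (s 0 - X) - xlnx (s 3 + s 4 + s 5 - X) - xlnx (X - s 4) - xlnx (X - s 3)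
      - xlnx (X - s 5) + xlnx (s 0 - s 3) + xlnx (s 3 + s 4) + xlnx (s 1 + s 2) + xlnx (s 0 - s 2)
      - xlnx (s 4 + s 6) - xlnx (s 0 - s 6) - xlnx (s 1 + s 6) := by
  simp only [valA, valF, aforms, formVal, featVal, coef, List.map_cons, List.map_nil, List.sum_cons, List.sum_nil,
    Fin.sum_univ_eight]
  simp
  ring_nf

/-- `valH` written out. -/
theorem valH_eq (s : Fin 8 → ℝ) (X z : ℝ) :
    valH s X z = xlnx (1 + z * s 6) + xlnx (1 + z * X) - xlnx (1 + z * (X + s 6 - s 0))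
      - xlnx (-1 + z * (s 1 + s 2 + s 7)) - xlnx (-1 + z * s 0) - xlnx (1 + z * (-s 7)) - xlnx (1 + z * (-s 2))
      - xlnx (1 + z * (-s 1)) := by
  simp only [valH, kforms, mval, featVal, coef, List.map_cons, List.map_nil, List.sum_cons, List.sum_nil,
    Fin.sum_univ_eight]
  simp
  ring_nf

/-- `Σ_k σ_k·m_k(s, X) = 0` identically (the `x`-parts of the two mixed forms cancel and
`q₃ + p₃ − p₀ − q₄ − q₅ = 0` in BZ's parameters). -/
theorem sum_sg_mval (s : Fin 8 → ℝ) (X : ℝ) : (kforms.map fun f => (f.sg : ℝ) * mval f s X).sum = 0 := by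
  simp only [kforms, mval, featVal, coef, List.map_cons, List.map_nil, List.sum_cons, List.sum_nil, Fin.sum_univ_eight]
  simp
  ring

/-- `xlnx (v/z) = xlnx(v)/z − (v/z)·log|z|` (`z ≠ 0`; both sides vanish in the `log` part when `v = 0`). -/
theorem xlnx_div {v z : ℝ} (hz : z ≠ 0) : xlnx (v / z) = xlnx v / z - v / z * Real.log |z| := by
  unfold xlnx
  rcases eq_or_ne v 0 with rfl | hv
  · simp
  · rw [abs_div, Real.log_div (abs_ne_zero.mpr hv) (abs_ne_zero.mpr hz)]
    field_simp
    ring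

/-- **THE FAR-CHART FORM OF THE VALUE FUNCTION**: for `z ≠ 0`, `valueV s X (1/z) = valA s X + valH s X z / z`. -/
theorem valueV_far (s : Fin 8 → ℝ) (X : ℝ) {z : ℝ} (hz : z ≠ 0) : valueV s X z⁻¹ = valA s X + valK s X z := by
  rw [Envelope.valueV_eq, valA_eq, valK, valH_eq]
  have h1 : z⁻¹ + s 6 = (1 + z * s 6) / z := by field_simp
  have h2 : X + z⁻¹ = (1 + z * X) / z := by field_simp; ring
  have h3 : X + z⁻¹ + s 6 - s 0 = (1 + z * (X + s 6 - s 0)) / z := by field_simp; ring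
  have h4 : s 1 + s 2 + s 7 - z⁻¹ = (-1 + z * (s 1 + s 2 + s 7)) / z := by field_simp; ring
  have h5 : s 0 - z⁻¹ = (-1 + z * s 0) / z := by field_simp; ring
  have h6 : z⁻¹ - s 7 = (1 + z * (-s 7)) / z := by field_simp; ring
  have h7 : z⁻¹ - s 2 = (1 + z * (-s 2)) / z := by field_simp; ring
  have h8 : z⁻¹ - s 1 = (1 + z * (-s 1)) / z := by field_simp; ring
  rw [h3, h2, h1, h4, h5, h6, h7, h8]
  simp only [xlnx_div hz]
  field_simp
  ring

/-! ### List forms of `H`, `K`, the log-form of `H′`, and z-pieces (used by the checker's soundness files) -/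

/-- `H` over a list of `Y`-forms (so that `valH = valHL kforms`). -/
def valHL (F : List KForm) (s : Fin 8 → ℝ) (X z : ℝ) : ℝ :=
  (F.map fun f => (f.sg : ℝ) * xlnx ((f.bp : ℝ) + z * mval f s X)).sum

/-- `K` over a list of `Y`-forms (so that `valK = valKL kforms`). -/
def valKL (F : List KForm) (s : Fin 8 → ℝ) (X z : ℝ) : ℝ :=
  (F.map fun f => (f.sg : ℝ) * xlnx ((f.bp : ℝ) + z * mval f s X)).sum / z

/-- The log-form of `H′`: `Σ σ_k m_k log|β′_k + z m_k|` over a list of `Y`-forms. -/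
def etaL (F : List KForm) (s : Fin 8 → ℝ) (X z : ℝ) : ℝ :=
  (F.map fun f => (f.sg : ℝ) * mval f s X * Real.log |(f.bp : ℝ) + z * mval f s X|).sum

/-- The z-piece `[za, zb]/zden` as a set of reals. -/
def zSeg (zden : ℕ) (za zb : ℤ) : Set ℝ := {z | (za : ℝ) ≤ z * zden ∧ z * zden ≤ (zb : ℝ)}

/-- `valH = valHL kforms`. -/
theorem valH_eq_valHL (s : Fin 8 → ℝ) (X z : ℝ) : valH s X z = valHL kforms s X z := rfl

/-- `valK = valKL kforms`. -/
theorem valK_eq_valKL (s : Fin 8 → ℝ) (X z : ℝ) : valK s X z = valKL kforms s X z := rfl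

/-- `valHL` of a cons. -/
theorem valHL_cons (f : KForm) (F : List KForm) (s : Fin 8 → ℝ) (X z : ℝ) :
    valHL (f :: F) s X z = (f.sg : ℝ) * xlnx ((f.bp : ℝ) + z * mval f s X) + valHL F s X z := by
  simp [valHL]

/-- `valKL` of a cons. -/
theorem valKL_cons (f : KForm) (F : List KForm) (s : Fin 8 → ℝ) (X z : ℝ) :
    valKL (f :: F) s X z = (f.sg : ℝ) * (xlnx ((f.bp : ℝ) + z * mval f s X) / z) + valKL F s X z := by
  simp [valKL, add_div, mul_div_assoc]

/-- `etaL` of a cons. -/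
theorem etaL_cons (f : KForm) (F : List KForm) (s : Fin 8 → ℝ) (X z : ℝ) :
    etaL (f :: F) s X z = (f.sg : ℝ) * mval f s X * Real.log |(f.bp : ℝ) + z * mval f s X| + etaL F s X z := by
  simp [etaL]

/-- The `t`-difference of `m` at fixed `X` is the feature difference. -/
theorem mval_sub (f : KForm) (t t' : Fin 8 → ℝ) (X : ℝ) : mval f t X - mval f t' X = featVal f.al t - featVal f.al t' := by
  unfold mval; ring

/-! ### The secant in the direction at a fixed far point -/

/-- **Resolved secant**: for a `Y`-form at fixed `(X, z)` (`z ≠ 0`) and two directions with `Y`-free parts `mt`, `mc`,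
if `β′ + z·mc` and `β′ + z·mt` have one strict sign with modulus in `[m, M]` (`m > 0`), then
`(xlnx(β′ + z·mt) − xlnx(β′ + z·mc))/z = θ·(mt − mc)` with `log m ≤ θ ≤ log M` — the `1/z` cancels exactly. -/
theorem kform_secant {m M bp z mt mc : ℝ} (hm : 0 < m) (hz : z ≠ 0)
    (hsign : (m ≤ bp + z * mc ∧ bp + z * mc ≤ M ∧ m ≤ bp + z * mt ∧ bp + z * mt ≤ M) ∨
      (m ≤ -(bp + z * mc) ∧ -(bp + z * mc) ≤ M ∧ m ≤ -(bp + z * mt) ∧ -(bp + z * mt) ≤ M)) :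
    ∃ θ : ℝ, Real.log m ≤ θ ∧ θ ≤ Real.log M ∧
      (xlnx (bp + z * mt) - xlnx (bp + z * mc)) / z = θ * (mt - mc) := by
  obtain ⟨θ, h1, h2, e⟩ := xlnx_secant (a := bp + z * mc) (b := bp + z * mt) hm hsign
  refine ⟨θ, h1, h2, ?_⟩
  rw [e]
  field_simp
  ring

/-! ### Tangent differences: the four one-sided bounds -/

/-- The tangent difference of `xlnx`: `xlnx b − xlnx a − (b − a)·log|a|`. -/
def tanD (a b : ℝ) : ℝ := xlnx b - xlnx a - (b - a) * Real.log |a|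

/-- Case `σ = 1`, `L > 0` (convex side): `tanD a b ≤ (b − a)²/(2m)` for `m ≤ a, b` (`m > 0`). -/
theorem tanD_le_of_pos {m a b : ℝ} (hm : 0 < m) (ha : m ≤ a) (hb : m ≤ b) : tanD a b ≤ (b - a) ^ 2 / (2 * m) :=
  (xlnx_tangent_quad_pos hm ha (le_max_left a b) hb (le_max_right a b)).2

/-- Case `σ = 1`, `L < 0` (concave side): `tanD a b ≤ −(b − a)²/(2M)` for `−a, −b ≤ M`. -/
theorem tanD_le_of_neg {M a b : ℝ} (ha : a < 0) (hb : b < 0) (haM : -a ≤ M) (hbM : -b ≤ M) :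
    tanD a b ≤ -((b - a) ^ 2 / (2 * M)) := by
  have hm : 0 < min (-a) (-b) := lt_min (by linarith) (by linarith)
  have := (xlnx_tangent_quad_neg hm (min_le_left _ _) haM (min_le_right _ _) hbM).1
  unfold tanD; linarith

/-- Case `σ = 1`, `L < 0`, no upper bound needed: `tanD a b ≤ 0`. -/
theorem tanD_nonpos_of_neg {a b : ℝ} (ha : a < 0) (hb : b < 0) : tanD a b ≤ 0 := by
  have h := tanD_le_of_neg ha hb (le_max_left (-a) (-b)) (le_max_right (-a) (-b))
  have hM : 0 < 2 * max (-a) (-b) := by have := le_max_left (-a) (-b); linarith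
  have : 0 ≤ (b - a) ^ 2 / (2 * max (-a) (-b)) := by positivity
  linarith

/-- Case `σ = −1`, `L > 0` (concave side of `−xlnx`): `−tanD a b ≤ −(b − a)²/(2M)` for `a, b ≤ M` (`a, b > 0`). -/
theorem neg_tanD_le_of_pos {M a b : ℝ} (ha : 0 < a) (hb : 0 < b) (haM : a ≤ M) (hbM : b ≤ M) :
    -tanD a b ≤ -((b - a) ^ 2 / (2 * M)) := by
  have hm : 0 < min a b := lt_min ha hb
  have := (xlnx_tangent_quad_pos hm (min_le_left _ _) haM (min_le_right _ _) hbM).1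
  unfold tanD; linarith

/-- Case `σ = −1`, `L > 0`, no upper bound needed: `−tanD a b ≤ 0`. -/
theorem neg_tanD_nonpos_of_pos {a b : ℝ} (ha : 0 < a) (hb : 0 < b) : -tanD a b ≤ 0 := by
  have h := neg_tanD_le_of_pos ha hb (le_max_left a b) (le_max_right a b)
  have hM : 0 < 2 * max a b := by have := le_max_left a b; linarith
  have : 0 ≤ (b - a) ^ 2 / (2 * max a b) := by positivity
  linarith

/-- Case `σ = −1`, `L < 0` (convex side of `−xlnx`): `−tanD a b ≤ (b − a)²/(2m)` for `m ≤ −a, −b` (`m > 0`). -/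
theorem neg_tanD_le_of_neg {m a b : ℝ} (hm : 0 < m) (ha : m ≤ -a) (hb : m ≤ -b) :
    -tanD a b ≤ (b - a) ^ 2 / (2 * m) :=
  (xlnx_tangent_quad_neg hm ha (le_max_left (-a) (-b)) hb (le_max_right (-a) (-b))).2

/-- **The tangent identity for a list of forms** at fixed `(s, Y)`: moving `X` from `a` to `b`,
`valF F s b Y − valF F s a Y − (b − a)·gxF F s a Y = Σ_k σ_k·tanD (L_k(a)) (L_k(b))`, with `L_k(b) − L_k(a) = β_k·(b − a)`. -/
theorem valF_tangent (s : Fin 8 → ℝ) (a b Y : ℝ) : ∀ F : List EForm,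
    valF F s b Y - valF F s a Y - (b - a) * gxF F s a Y
      = (F.map fun f => (f.sg : ℝ) * tanD (formVal f s a Y) (formVal f s b Y)).sum
  | [] => by simp [valF_nil, gxF_nil]
  | f :: F => by
    rw [valF_cons, valF_cons, gxF_cons, List.map_cons, List.sum_cons, ← valF_tangent s a b Y F]
    have e : formVal f s b Y - formVal f s a Y = (f.bx : ℝ) * (b - a) := by unfold formVal; ring
    unfold tanD
    rw [e]
    ring

/-! ### The chain lemma: local tangent inequalities on consecutive pieces give the global one -/

/-- Two-way local tangent inequalities order the slopes: if `f b ≤ f a + (b−a)·g a` and `f a ≤ f b + (a−b)·g b` with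
`a < b` then `g b ≤ g a`. -/
theorem slope_antitone_of_two {f g : ℝ → ℝ} {a b : ℝ} (hab : a < b) (h1 : f b ≤ f a + (b - a) * g a)
    (h2 : f a ≤ f b + (a - b) * g b) : g b ≤ g a := by
  nlinarith

/-- Monotone breakpoints: `P 0 ≤ P n`. -/
theorem P_zero_le {P : ℕ → ℝ} : ∀ n : ℕ, (∀ j < n, P j ≤ P (j + 1)) → P 0 ≤ P n
  | 0, _ => le_rfl
  | n + 1, h => (P_zero_le n fun j hj => h j (by omega)).trans (h n (by omega))

/-- **THE CHAIN LEMMA.** Breakpoints `P 0 ≤ P 1 ≤ ⋯ ≤ P n`; on every piece `[P j, P (j+1)]` the two-point tangent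
inequality `f b ≤ f a + (b − a)·g a` holds for all `a, b` of the piece. Then it holds for all `a, b ∈ [P 0, P n]`.
(Calculus-free: `g` is antitone piece by piece and the inequalities telescope through the breakpoints.) -/
theorem tangent_chain {f g : ℝ → ℝ} {P : ℕ → ℝ} :
    ∀ n : ℕ, (∀ j < n, P j ≤ P (j + 1)) →
      (∀ j < n, ∀ a ∈ Icc (P j) (P (j + 1)), ∀ b ∈ Icc (P j) (P (j + 1)), f b ≤ f a + (b - a) * g a) →
      ∀ a ∈ Icc (P 0) (P n), ∀ b ∈ Icc (P 0) (P n), f b ≤ f a + (b - a) * g a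
  | 0, _, _ => by
    intro a ha b hb
    have ea : a = P 0 := le_antisymm ha.2 ha.1
    have eb : b = P 0 := le_antisymm hb.2 hb.1
    rw [ea, eb]; simp
  | n + 1, hmono, hloc => by
    have hmono' : ∀ j < n, P j ≤ P (j + 1) := fun j hj => hmono j (by omega)
    have hloc' : ∀ j < n, ∀ a ∈ Icc (P j) (P (j + 1)), ∀ b ∈ Icc (P j) (P (j + 1)), f b ≤ f a + (b - a) * g a :=
      fun j hj => hloc j (by omega)
    have IH := tangent_chain n hmono' hloc'
    have hL := hloc n (by omega)
    have h0n : P 0 ≤ P n := P_zero_le n hmono'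
    have hn1 : P n ≤ P (n + 1) := hmono n (by omega)
    have hPn_lo : P n ∈ Icc (P 0) (P n) := ⟨h0n, le_rfl⟩
    have hPn_hi : P n ∈ Icc (P n) (P (n + 1)) := ⟨le_rfl, hn1⟩
    intro a ha b hb
    rcases le_total a (P n) with haL | haR <;> rcases le_total b (P n) with hbL | hbR
    · exact IH a ⟨ha.1, haL⟩ b ⟨hb.1, hbL⟩
    · -- `a` low, `b` high: through `P n`
      have h1 := hL (P n) hPn_hi b ⟨hbR, hb.2⟩
      have h2 := IH a ⟨ha.1, haL⟩ (P n) hPn_lo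
      have hg : (b - P n) * g (P n) ≤ (b - P n) * g a := by
        rcases eq_or_lt_of_le haL with heq | hlt
        · rw [heq]
        · have h3 := IH (P n) hPn_lo a ⟨ha.1, haL⟩
          have := slope_antitone_of_two hlt h2 h3
          exact mul_le_mul_of_nonneg_left this (by linarith)
      nlinarith
    · -- `a` high, `b` low: through `P n`
      have h1 := IH (P n) hPn_lo b ⟨hb.1, hbL⟩
      have h2 := hL a ⟨haR, ha.2⟩ (P n) hPn_hi
      have hg : (b - P n) * g (P n) ≤ (b - P n) * g a := by
        rcases eq_or_lt_of_le haR with heq | hlt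
        · rw [← heq]
        · have h3 := hL (P n) hPn_hi a ⟨haR, ha.2⟩
          have := slope_antitone_of_two hlt h3 h2
          exact mul_le_mul_of_nonpos_left this (by linarith)
      nlinarith
    · exact hL a ⟨haR, ha.2⟩ b ⟨hbR, hb.2⟩

/-- **At a point of the interval where the slope vanishes the function is maximal** (global tangent inequality with
`g a = 0`). -/
theorem le_of_tangent_of_eq_zero {f g : ℝ → ℝ} {lo hi : ℝ}
    (h : ∀ a ∈ Icc lo hi, ∀ b ∈ Icc lo hi, f b ≤ f a + (b - a) * g a) {a b : ℝ} (ha : a ∈ Icc lo hi)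
    (hb : b ∈ Icc lo hi) (hg : g a = 0) : f b ≤ f a := by
  have := h a ha b hb
  rw [hg, mul_zero, add_zero] at this
  exact this

end FarSlice

end Summit.KontsevichZagierPeriods.Zeta5Search.Barrier.ConeGamma

end
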